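import Mathlib
import HarnessLib
import Summits.KontsevichZagierPeriods.KontsevichZagierPeriods.Theses.LinRedNormalForm
import Literature.NumberTheory.Transcendental.KZRelationsLE
import Literature.NumberTheory.Transcendental.KZLocalCalculus

/-!
# Sketch — crux-ideate round 1, ideator 1, crux `ArrangementNormalForm` (stmt-KontsevichZagierPeriods-3915)

First lemmas of the three idea cards (they need not be proved; they must elaborate):

* `JanusOneLetter`        — card `janus-bands`;
* `ArrangementNormalFormLE`, `ShadowFreeDimTwo`, `transferLE` — card `shadow-free-refibration`;
* `ratAdm`, `RationalCertificateANF`, `AomotoReductionDimTwo`, `transferRat` — card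
  `rational-stokes-descent`.

The two `transfer*` theorems are PROVED: each transferred form C⁺ implies the crux verbatim.
-/

noncomputable section

open MeasureTheory Set

namespace Summit.KontsevichZagierPeriods.KontsevichZagierPeriods.Cruxes.ArrangementNormalForm.Sketch

open Literature.NumberTheory.Transcendental

/-- The generating set of HYPERLOGARITHM WORD representations `[Δ_w, q·∏ (tᵢ − aᵢ)⁻¹]`, `aᵢ, q ∈ ℚ`
— verbatim the set in the crux `LinRedNormalForm.ArrangementNormalForm`. -/
def wordGens : Set KZ.FormalRep :=
  {y : KZ.FormalRep | ∃ (w : ℕ) (a : Fin w → ℚ) (q : ℚ) (s : KZ.IntegralRep w),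
    s.domain = {t | (∀ i, 0 < t i) ∧ (∀ i, t i < 1) ∧ StrictAnti t} ∧
    Set.EqOn s.integrand (fun t => (q : ℝ) * ∏ i, 1 / (t i - (a i : ℝ))) s.domain ∧ y = KZ.of s}

/-- Word representations of length at most `d`. -/
def wordGensLE (d : ℕ) : Set KZ.FormalRep :=
  {y : KZ.FormalRep | ∃ (w : ℕ) (a : Fin w → ℚ) (q : ℚ) (s : KZ.IntegralRep w), w ≤ d ∧
    s.domain = {t | (∀ i, 0 < t i) ∧ (∀ i, t i < 1) ∧ StrictAnti t} ∧
    Set.EqOn s.integrand (fun t => (q : ℝ) * ∏ i, 1 / (t i - (a i : ℝ))) s.domain ∧ y = KZ.of s}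

/-! ## Card `janus-bands` — first lemma -/

/-- **JanusOneLetter** (first lemma of card `janus-bands`). The smallest family in which the
two-ended ("Janus") band is forced: a 2-cell fibred over `x ∈ (0,1)` with affine fibre
`α(x) < y < β(x)`, ONE fibre letter `y = ℓ(x)` (affine, rational) and ONE base pole `x = p`
(`p ∈ ℚ`, the pinch points `p = 0, 1` allowed). Absolute convergence is the field `r.integrableOn`.
Claim: `[r]` is KZ-equivalent to a `ℤ`-combination of word representations of length `≤ 2`.
When `p = 1` and the fibre pinches at `x = 1` (`α 1 = β 1`) the 0-based unfolding of
`∫_{α x}^{β x} dy/(y − ℓ x)` splits into individually divergent pieces; the 1-based band does not. -/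
def JanusOneLetter : Prop :=
  ∀ (α₀ α₁ β₀ β₁ ℓ₀ ℓ₁ p : ℚ) (r : KZ.IntegralRep 2),
    r.domain = {x | 0 < x 0 ∧ x 0 < 1 ∧ (α₀ : ℝ) + α₁ * x 0 < x 1 ∧ x 1 < (β₀ : ℝ) + β₁ * x 0} →
    Set.EqOn r.integrand (fun x => 1 / ((x 1 - ((ℓ₀ : ℝ) + ℓ₁ * x 0)) * (x 0 - (p : ℝ)))) r.domain →
    ∃ c ∈ AddSubgroup.closure (wordGensLE 2), KZ.of r - c ∈ KZ.relations

/-! ## Card `shadow-free-refibration` — transfer C⁺ and first lemma -/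

/-- **C⁺ of card `shadow-free-refibration`**: the crux with `KZ.relations` replaced by the
dimension-truncated calculus `KZ.relationsLE n` — the normal-form chain of an `n`-dimensional
arrangement representation never visits a representation of dimension `> n` (no unfolding
variables: the word variables are the sheared original coordinates). -/
def ArrangementNormalFormLE (n : ℕ) : Prop :=
  ∀ (m m' : ℕ) (r : KZ.IntegralRep n) (M : Fin m' → (Fin n → ℚ) × ℚ) (L : Fin m → (Fin n → ℚ) × ℚ)
    (e : Fin m → ℕ) (p : MvPolynomial (Fin n) ℚ),
    r.domain = {x | ∀ j, 0 < ∑ i, ((M j).1 i : ℝ) * x i + ((M j).2 : ℝ)} →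
    Set.EqOn r.integrand
      (fun x => MvPolynomial.aeval x p / ∏ j, (∑ i, ((L j).1 i : ℝ) * x i + ((L j).2 : ℝ)) ^ e j)
      r.domain →
    ∃ c ∈ AddSubgroup.closure wordGens, KZ.of r - c ∈ KZ.relationsLE n

/-- **ShadowFreeDimTwo** (first lemma of card `shadow-free-refibration`): the planar case of C⁺ —
every absolutely convergent rational representation on an open rational polygon with poles on a
rational line arrangement is tied to a `ℤ`-combination of word representations by a chain of moves
among representations of dimension `≤ 2`. -/
def ShadowFreeDimTwo : Prop := ArrangementNormalFormLE 2

/-- The transfer is honest: C⁺ (all dimensions) implies the crux verbatim, because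
`KZ.relationsLE n ≤ KZ.relations`. PROVED. -/
theorem transferLE (h : ∀ n, ArrangementNormalFormLE n) :
    Summit.KontsevichZagierPeriods.KontsevichZagierPeriods.Theses.LinRedNormalForm.ArrangementNormalForm := by
  intro n m m' r M L e p hdom hint
  obtain ⟨c, hc, hrel⟩ := h n m m' r M L e p hdom hint
  exact ⟨c, hc, KZ.relationsLE_le_relations n hrel⟩

/-! ## Card `rational-stokes-descent` — the rational-certificate sub-calculus, transfer, first lemma -/

/-- Admissible move data with RATIONAL CERTIFICATES: additivity unrestricted; changes of variables
given coordinatewise by quotients of `ℚ`-polynomials (affine maps, projectivities, monomial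
blow-ups); Newton–Leibniz moves whose primitive `F` agrees on the band with a quotient of
`ℚ`-polynomials. (The sub-calculus is `KZ.localRelationsOf ratAdm`.) -/
def ratAdm : Set KZ.MoveDatum :=
  {δ | match δ with
    | .domainAdd _ => True
    | .integrandAdd _ => True
    | .changeOfVariables d => ∃ (P Q : Fin d.n → MvPolynomial (Fin d.n) ℚ),
        ∀ x ∈ d.r.domain, d.Φ x = fun i => MvPolynomial.aeval x (P i) / MvPolynomial.aeval x (Q i)
    | .newtonLeibniz d => ∃ (P Q : MvPolynomial (Fin (d.n + 1)) ℚ),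
        ∀ z ∈ d.r.domain, d.F z = MvPolynomial.aeval z P / MvPolynomial.aeval z Q}

/-- **C⁺ of card `rational-stokes-descent`**: the crux inside the rational-certificate
sub-calculus — no transcendental (or even irrational algebraic) primitive and no irrational
substitution is ever used: all move data lie in `ℚ(x)`. -/
def RationalCertificateANF : Prop :=
  ∀ (n m m' : ℕ) (r : KZ.IntegralRep n) (M : Fin m' → (Fin n → ℚ) × ℚ) (L : Fin m → (Fin n → ℚ) × ℚ)
    (e : Fin m → ℕ) (p : MvPolynomial (Fin n) ℚ),
    r.domain = {x | ∀ j, 0 < ∑ i, ((M j).1 i : ℝ) * x i + ((M j).2 : ℝ)} →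
    Set.EqOn r.integrand
      (fun x => MvPolynomial.aeval x p / ∏ j, (∑ i, ((L j).1 i : ℝ) * x i + ((L j).2 : ℝ)) ^ e j)
      r.domain →
    ∃ c ∈ AddSubgroup.closure wordGens, KZ.of r - c ∈ KZ.localRelationsOf ratAdm

/-- The transfer is honest: `KZ.localRelationsOf ratAdm ≤ KZ.relations`. PROVED. -/
theorem transferRat (h : RationalCertificateANF) :
    Summit.KontsevichZagierPeriods.KontsevichZagierPeriods.Theses.LinRedNormalForm.ArrangementNormalForm := by
  intro n m m' r M L e p hdom hint
  obtain ⟨c, hc, hrel⟩ := h n m m' r M L e p hdom hint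
  exact ⟨c, hc, KZ.localRelationsOf_le_relations ratAdm hrel⟩

/-- Planar AOMOTO generators: `[polygon, q / (L · L')]` with `L, L'` rational affine forms whose
linear parts are independent (a logarithmic `2`-form `q·dlog L ∧ dlog L'` up to the rational
constant `det`, absorbed in `q`), on an open rational polygon. -/
def aomotoGensTwo : Set KZ.FormalRep :=
  {y : KZ.FormalRep | ∃ (k : ℕ) (M : Fin k → (Fin 2 → ℚ) × ℚ) (u v : (Fin 2 → ℚ) × ℚ) (q : ℚ)
      (s : KZ.IntegralRep 2),
    u.1 0 * v.1 1 - u.1 1 * v.1 0 ≠ 0 ∧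
    s.domain = {x | ∀ j, 0 < ∑ i, ((M j).1 i : ℝ) * x i + ((M j).2 : ℝ)} ∧
    Set.EqOn s.integrand (fun x => (q : ℝ) /
      ((∑ i, (u.1 i : ℝ) * x i + (u.2 : ℝ)) * (∑ i, (v.1 i : ℝ) * x i + (v.2 : ℝ)))) s.domain ∧
    y = KZ.of s}

/-- **AomotoReductionDimTwo** (first lemma of card `rational-stokes-descent`): in the plane, every
absolutely convergent arrangement representation is congruent, modulo moves with RATIONAL
CERTIFICATES only, to a `ℤ`-combination of planar Aomoto representations (pure weight 2) and word
representations of length `≤ 1` (the impure part has DESCENDED in dimension through Newton–Leibniz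
moves with rational primitives). Orlik–Solomon/Brieskorn supplies the decomposition
`P dx∧dy/∏Lⱼ^{eⱼ} = Σ c_{ij} dlog Lᵢ ∧ dlog Lⱼ + dη` with `c ∈ ℚ`, `η` rational; the content is that
`η` can be chosen TAME (every piece absolutely convergent) — the double residue of a convergent
integrand at a vertex of the closed cell vanishes, so no divergent `dlog ∧ dlog` survives. -/
def AomotoReductionDimTwo : Prop :=
  ∀ (m m' : ℕ) (r : KZ.IntegralRep 2) (M : Fin m' → (Fin 2 → ℚ) × ℚ) (L : Fin m → (Fin 2 → ℚ) × ℚ)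
    (e : Fin m → ℕ) (p : MvPolynomial (Fin 2) ℚ),
    r.domain = {x | ∀ j, 0 < ∑ i, ((M j).1 i : ℝ) * x i + ((M j).2 : ℝ)} →
    Set.EqOn r.integrand
      (fun x => MvPolynomial.aeval x p / ∏ j, (∑ i, ((L j).1 i : ℝ) * x i + ((L j).2 : ℝ)) ^ e j)
      r.domain →
    ∃ c ∈ AddSubgroup.closure (aomotoGensTwo ∪ wordGensLE 1), KZ.of r - c ∈ KZ.localRelationsOf ratAdm

end Summit.KontsevichZagierPeriods.KontsevichZagierPeriods.Cruxes.ArrangementNormalForm.Sketch
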